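import Mathlib
import HarnessLib
import Summits.Ventures.LatticeQCDFlow.Scaling.JarzynskiSampleSize

/-!
# SampleSizeSufficientCorrelated — the SUFFICIENCY half of Chatterjee–Diaconis for CORRELATED draws
# with a variance-inflation factor `C` (e.g. `C ≈ 2τ_int` of a stationary restart chain):
# `N ≥ e^{L + t}` draws give `E|I_N(f) − I(f)| ≤ ‖f‖_{L²(ν)}·(√C·e^{−t/4} + 2√(P_ν{ρ > e^{L + t/2}}))`

HONEST FRAMING: exact (Metropolis-corrected) sampling algorithms for lattice gauge theory;
figures of merit are autocorrelation/cost numbers at stated couplings and volumes; no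
continuum-physics claim.

Venture `LatticeQCDFlow` (cell pub-lqcd), topic `Scaling`; FANOUT row 19 (`su2-snf`, GEN-7).
OUR WORK (elementary finite sums), nothing cited as a fact.  Companion of
`Scaling/SampleSizeIdenticalMarginals` (necessity needs only identical marginals).  The printed
proof of the sufficiency half of Chatterjee–Diaconis 2018 Thm 1.1 (§4: truncate `f` at
`ρ ≤ a = e^{L + t/2}`, two Cauchy–Schwarz tail terms, ONE variance bound `Var(I_N h) = Var(hρ)/N`)
uses independence ONLY in that variance bound.  Replacing it by a VARIANCE-INFLATION hypothesis —
for every `g`, `Var_Q(Σᵢ g(xᵢ)) ≤ C·N·Var_q(g)` (`C = 1` for independent or pairwise-uncorrelated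
draws; `C ≤ 1 + 2Σ_k ρ_k`, an integrated-autocorrelation factor, for a stationary chain of starts,
row 8's `Scoring/RestartChain*` vocabulary) — gives the same conclusion with `e^{−t/4}` inflated by
`√C`, i.e. with `N` replaced by the effective number of draws `N/C`:

* **`sampleSize_sufficient_of_varianceInflation`** — finite laws `q > 0`, `p ≥ 0` normalised,
  `L = klFin p q`, any joint law `Q ≥ 0`, `Σ Q = 1` on `Fin N → Ω` with one-draw marginals `q` and
  variance inflation `C ≥ 0`; `t` real, `N ≥ e^{L + t}`, `N ≠ 0`:
  `Σ_x Q(x)|(1/N)Σᵢ f(xᵢ)p(xᵢ)/q(xᵢ) − Σ p f| ≤ √(Σ p f²)·(√C·e^{−t/4} + 2·√(P_p{ρ > e^{L + t/2}}))`;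
* **`jarzynski_sampleSize_sufficient_of_varianceInflation`** — the NE-MCMC reading for forward
  evolutions with `P_F` marginals and inflation `C`: `N ≥ C-corrected e^{ΔF − ⟨W⟩_R̃ + t}` … stated as
  `N ≥ exp(ΔF − ⟨W⟩_R̃ + t)` ⇒ `E|(1/N)Σᵢ f(ωⁱ)e^{−(Wᵢ−ΔF)} − ⟨f⟩_R̃| ≤ √⟨f²⟩_R̃·(√C e^{−t/4} + 2√(P̃_R{W < ⟨W⟩_R̃ − t/2}))`.

NOT CLAIMED: any value of `C` for a concrete restart chain (an INPUT, to be read off the chain's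
autocorrelation of the reweighted observable); non-stationary starts.
-/

namespace Summit.Ventures.LatticeQCDFlow.Theory2

open Finset
open Literature.Probability.MarkovChains (IsRowStochastic IsStationary)
open Summit.Ventures.LatticeQCDFlow.Exactness

variable {Ω : Type*} [Fintype Ω]

/-! ## §1 Weighted Cauchy–Schwarz helpers -/

/-- `E_Q|F| ≤ √(E_Q F²)` for a probability vector `Q`. -/
theorem sum_mul_abs_le_sqrt_sum_mul_sq {X : Type*} [Fintype X] {Q : X → ℝ} (hQ : ∀ x, 0 ≤ Q x)
    (hQ1 : ∑ x, Q x = 1) (F : X → ℝ) :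
    ∑ x, Q x * |F x| ≤ Real.sqrt (∑ x, Q x * F x ^ 2) := by
  have hcs := Finset.sum_mul_sq_le_sq_mul_sq univ (fun x => Real.sqrt (Q x))
    (fun x => Real.sqrt (Q x) * |F x|)
  have e1 : ∀ x, Real.sqrt (Q x) * (Real.sqrt (Q x) * |F x|) = Q x * |F x| := fun x => by
    rw [← mul_assoc, Real.mul_self_sqrt (hQ x)]
  have e2 : ∀ x, Real.sqrt (Q x) ^ 2 = Q x := fun x => Real.sq_sqrt (hQ x)
  have e3 : ∀ x, (Real.sqrt (Q x) * |F x|) ^ 2 = Q x * F x ^ 2 := fun x => by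
    rw [mul_pow, Real.sq_sqrt (hQ x), sq_abs]
  simp_rw [e1, e2, e3, hQ1, one_mul] at hcs
  have h0 : 0 ≤ ∑ x, Q x * |F x| := sum_nonneg fun x _ => mul_nonneg (hQ x) (abs_nonneg _)
  rw [← Real.sqrt_sq h0]
  exact Real.sqrt_le_sqrt hcs

/-- `Σ p |f| 1_A ≤ √(Σ p f²) · √(Σ_A p)` for `p ≥ 0` (Cauchy–Schwarz on the tail). -/
theorem sum_mul_abs_indicator_le {p f : Ω → ℝ} (hp : ∀ ω, 0 ≤ p ω) (A : Ω → Prop)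
    [DecidablePred A] :
    ∑ ω, p ω * |f ω| * (if A ω then 1 else 0)
      ≤ Real.sqrt (∑ ω, p ω * f ω ^ 2) * Real.sqrt (∑ ω, if A ω then p ω else 0) := by
  have hcs := Finset.sum_mul_sq_le_sq_mul_sq univ (fun ω => Real.sqrt (p ω) * |f ω|)
    (fun ω => Real.sqrt (p ω) * (if A ω then 1 else 0))
  have e1 : ∀ ω, Real.sqrt (p ω) * |f ω| * (Real.sqrt (p ω) * (if A ω then 1 else 0))
      = p ω * |f ω| * (if A ω then 1 else 0) := fun ω => by
    have := Real.mul_self_sqrt (hp ω)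
    split_ifs
    · rw [mul_one, mul_one, mul_comm (Real.sqrt _ * |f ω|), ← mul_assoc, this]
    · simp
  have e2 : ∀ ω, (Real.sqrt (p ω) * |f ω|) ^ 2 = p ω * f ω ^ 2 := fun ω => by
    rw [mul_pow, Real.sq_sqrt (hp ω), sq_abs]
  have e3 : ∀ ω, (Real.sqrt (p ω) * (if A ω then 1 else 0)) ^ 2 = (if A ω then p ω else 0) :=
    fun ω => by
      split_ifs
      · rw [mul_one, Real.sq_sqrt (hp ω)]
      · simp
  simp_rw [e1, e2, e3] at hcs
  have h0 : 0 ≤ ∑ ω, p ω * |f ω| * (if A ω then 1 else 0) :=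
    sum_nonneg fun ω _ => mul_nonneg (mul_nonneg (hp ω) (abs_nonneg _)) (by split_ifs <;> simp)
  rw [← Real.sqrt_sq h0, ← Real.sqrt_mul (sum_nonneg fun ω _ => mul_nonneg (hp ω) (sq_nonneg _))]
  exact Real.sqrt_le_sqrt hcs

/-! ## §2 Sufficiency with a variance-inflation factor -/

/-- **CHATTERJEE–DIACONIS, SUFFICIENCY, CORRELATED DRAWS WITH VARIANCE INFLATION `C`.**  Finite laws
`q > 0` (proposal), `p ≥ 0` (target), both normalised, `L = klFin p q`, `f : Ω → ℝ`; a joint law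
`Q ≥ 0`, `Σ Q = 1` of `N ≥ 1` draws with one-draw marginals `q` and, for every `g`,
`Var_Q(Σᵢ g(xᵢ)) ≤ C·N·Var_q(g)`; any `t` with `N ≥ e^{L + t}`.  Then
`E_Q|(1/N)Σᵢ f(xᵢ)ρ(xᵢ) − Σ p f| ≤ √(Σ p f²)·(√C·e^{−t/4} + 2√(P_p{ρ > e^{L + t/2}}))`. -/
theorem sampleSize_sufficient_of_varianceInflation {p q : Ω → ℝ} (hq : ∀ ω, 0 < q ω)
    (hq1 : ∑ ω, q ω = 1) (hp : ∀ ω, 0 ≤ p ω) {N : ℕ} (hN0 : N ≠ 0)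
    {Q : (Fin N → Ω) → ℝ} (hQ : ∀ x, 0 ≤ Q x) (hQ1 : ∑ x, Q x = 1)
    (hmarg : ∀ (i : Fin N) (g : Ω → ℝ), ∑ x, Q x * g (x i) = ∑ ω, q ω * g ω)
    {C : ℝ} (hC : 0 ≤ C)
    (hvar : ∀ g : Ω → ℝ, ∑ x, Q x * (∑ i, (g (x i) - ∑ ω, q ω * g ω)) ^ 2
      ≤ C * N * ∑ ω, q ω * (g ω - ∑ ω', q ω' * g ω') ^ 2)
    (f : Ω → ℝ) {t : ℝ} (hN : Real.exp (klFin p q + t) ≤ N) :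
    ∑ x, Q x * |(1 / (N : ℝ)) * ∑ i, f (x i) * (p (x i) / q (x i)) - ∑ ω, p ω * f ω|
      ≤ Real.sqrt (∑ ω, p ω * f ω ^ 2) *
          (Real.sqrt C * Real.exp (-t / 4)
            + 2 * Real.sqrt (∑ ω, if Real.exp (klFin p q + t / 2) < p ω / q ω then p ω else 0)) := by
  classical
  -- notation
  set L := klFin p q with hL
  set a := Real.exp (L + t / 2) with ha
  have ha0 : 0 < a := Real.exp_pos _
  have hNr : (0 : ℝ) < N := Nat.cast_pos.mpr (Nat.pos_of_ne_zero hN0)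
  have hρ0 : ∀ ω, 0 ≤ p ω / q ω := fun ω => div_nonneg (hp ω) (hq ω).le
  have hqρ : ∀ ω, q ω * (p ω / q ω) = p ω := fun ω => by field_simp [(hq ω).ne']
  -- the truncation `h = f 1{ρ ≤ a}` and `g = h ρ`
  let h : Ω → ℝ := fun ω => if p ω / q ω ≤ a then f ω else 0
  have hhdef : ∀ ω, h ω = if p ω / q ω ≤ a then f ω else 0 := fun ω => rfl
  let g : Ω → ℝ := fun ω => h ω * (p ω / q ω)
  have hgdef : ∀ ω, g ω = h ω * (p ω / q ω) := fun ω => rfl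
  set S2 := ∑ ω, p ω * f ω ^ 2 with hS2
  have hS20 : 0 ≤ S2 := sum_nonneg fun ω _ => mul_nonneg (hp ω) (sq_nonneg _)
  set T := ∑ ω, (if a < p ω / q ω then p ω else 0) with hT
  -- |f − h| = |f| 1{ρ > a}
  have hfh : ∀ ω, |f ω - h ω| = |f ω| * (if a < p ω / q ω then 1 else 0) := fun ω => by
    rw [hhdef]
    by_cases hc : p ω / q ω ≤ a
    · rw [if_pos hc, if_neg (not_lt.mpr hc), sub_self, abs_zero, mul_zero]
    · rw [if_neg hc, if_pos (not_le.mp hc), sub_zero, mul_one]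
  -- the three-term split, pointwise
  have hsplit : ∀ x : Fin N → Ω,
      |(1 / (N : ℝ)) * ∑ i, f (x i) * (p (x i) / q (x i)) - ∑ ω, p ω * f ω|
        ≤ (1 / (N : ℝ)) * ∑ i, |f (x i) - h (x i)| * (p (x i) / q (x i))
          + |(1 / (N : ℝ)) * ∑ i, g (x i) - ∑ ω, p ω * h ω|
          + ∑ ω, p ω * |f ω - h ω| := by
    intro x
    have e1 : (1 / (N : ℝ)) * ∑ i, f (x i) * (p (x i) / q (x i)) - ∑ ω, p ω * f ω
        = ((1 / (N : ℝ)) * ∑ i, (f (x i) - h (x i)) * (p (x i) / q (x i)))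
          + ((1 / (N : ℝ)) * ∑ i, g (x i) - ∑ ω, p ω * h ω)
          + (∑ ω, p ω * (h ω - f ω)) := by
      simp only [hgdef, sub_mul, sum_sub_distrib, mul_sub]
      ring
    rw [e1]
    refine (abs_add_le _ _).trans (add_le_add ((abs_add_le _ _).trans (add_le_add ?_ le_rfl)) ?_)
    · rw [abs_mul, abs_of_pos (by positivity : (0 : ℝ) < 1 / N)]
      refine mul_le_mul_of_nonneg_left ((abs_sum_le_sum_abs _ _).trans (le_of_eq ?_))
        (by positivity)
      exact sum_congr rfl fun i _ => by rw [abs_mul, abs_of_nonneg (hρ0 _)]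
    · refine (abs_sum_le_sum_abs _ _).trans (le_of_eq (sum_congr rfl fun ω _ => ?_))
      rw [abs_mul, abs_of_nonneg (hp ω), abs_sub_comm]
  -- term (i): E_Q of the first piece = Σ p |f − h| = Σ p|f| 1{ρ > a} ≤ √S2 √T
  have htail : ∑ ω, p ω * |f ω - h ω| ≤ Real.sqrt S2 * Real.sqrt T := by
    have := sum_mul_abs_indicator_le (f := f) hp (fun ω => a < p ω / q ω)
    simp_rw [hfh, ← mul_assoc]
    exact this
  have hterm1 : ∑ x, Q x * ((1 / (N : ℝ)) * ∑ i, |f (x i) - h (x i)| * (p (x i) / q (x i)))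
      ≤ Real.sqrt S2 * Real.sqrt T := by
    have e : ∑ x, Q x * ((1 / (N : ℝ)) * ∑ i, |f (x i) - h (x i)| * (p (x i) / q (x i)))
        = ∑ ω, p ω * |f ω - h ω| := by
      have e1 : ∀ x, Q x * ((1 / (N : ℝ)) * ∑ i, |f (x i) - h (x i)| * (p (x i) / q (x i)))
          = (1 / (N : ℝ)) * ∑ i, Q x * (|f (x i) - h (x i)| * (p (x i) / q (x i))) := by
        intro x; rw [mul_sum, mul_sum, mul_sum]; exact sum_congr rfl fun i _ => by ring
      simp_rw [e1]
      rw [← mul_sum, sum_comm]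
      simp_rw [hmarg _ (fun ω => |f ω - h ω| * (p ω / q ω))]
      rw [sum_const, card_univ, Fintype.card_fin, nsmul_eq_mul, ← mul_assoc,
        one_div_mul_cancel hNr.ne', one_mul]
      exact sum_congr rfl fun ω _ => by rw [← mul_assoc, mul_comm (q ω), mul_assoc, hqρ, mul_comm]
    rw [e]; exact htail
  -- term (ii): E_Q|I_N h − I h| ≤ √(Var_Q/N²) ≤ √(C a S2 / N)
  have hmean : ∑ ω, q ω * g ω = ∑ ω, p ω * h ω :=
    sum_congr rfl fun ω _ => by rw [hgdef, ← mul_assoc, mul_comm (q ω), mul_assoc, hqρ, mul_comm]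
  have hterm2 : ∑ x, Q x * |(1 / (N : ℝ)) * ∑ i, g (x i) - ∑ ω, p ω * h ω|
      ≤ Real.sqrt S2 * (Real.sqrt C * Real.exp (-t / 4)) := by
    have hcs := sum_mul_abs_le_sqrt_sum_mul_sq hQ hQ1
      (fun x : Fin N → Ω => (1 / (N : ℝ)) * ∑ i, g (x i) - ∑ ω, p ω * h ω)
    refine hcs.trans ?_
    -- the second moment under Q is (1/N²)·Var_Q(Σ g) ≤ C Var_q(g)/N ≤ C a S2/N
    have e2 : ∀ x : Fin N → Ω, ((1 / (N : ℝ)) * ∑ i, g (x i) - ∑ ω, p ω * h ω) ^ 2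
        = (1 / (N : ℝ)) ^ 2 * (∑ i, (g (x i) - ∑ ω, q ω * g ω)) ^ 2 := by
      intro x
      rw [hmean, sum_sub_distrib, sum_const, card_univ, Fintype.card_fin, nsmul_eq_mul]
      field_simp
    simp_rw [e2]
    have hV := hvar g
    have hVq : ∑ ω, q ω * (g ω - ∑ ω', q ω' * g ω') ^ 2 ≤ a * S2 := by
      -- Var_q(g) ≤ E_q g² ≤ a Σ p f²
      have hv1 : ∑ ω, q ω * (g ω - ∑ ω', q ω' * g ω') ^ 2
          = ∑ ω, q ω * g ω ^ 2 - (∑ ω, q ω * g ω) ^ 2 := by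
        have e : ∀ ω, q ω * (g ω - ∑ ω', q ω' * g ω') ^ 2
            = q ω * g ω ^ 2 - 2 * (∑ ω', q ω' * g ω') * (q ω * g ω)
              + (∑ ω', q ω' * g ω') ^ 2 * q ω := fun ω => by ring
        simp_rw [e, sum_add_distrib, sum_sub_distrib, ← mul_sum, hq1]
        ring
      rw [hv1]
      have hE2 : ∑ ω, q ω * g ω ^ 2 ≤ a * S2 := by
        rw [hS2, mul_sum]
        refine sum_le_sum fun ω _ => ?_
        rw [hgdef, hhdef]
        by_cases hc : p ω / q ω ≤ a
        · rw [if_pos hc]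
          have : q ω * (f ω * (p ω / q ω)) ^ 2 = (p ω * f ω ^ 2) * (p ω / q ω) := by
            field_simp [(hq ω).ne']
          rw [this]
          calc p ω * f ω ^ 2 * (p ω / q ω) ≤ p ω * f ω ^ 2 * a :=
                mul_le_mul_of_nonneg_left hc (mul_nonneg (hp ω) (sq_nonneg _))
            _ = a * (p ω * f ω ^ 2) := by ring
        · rw [if_neg hc]
          simp only [zero_mul, ne_eq, OfNat.ofNat_ne_zero, not_false_eq_true, zero_pow, mul_zero]
          exact mul_nonneg ha0.le (mul_nonneg (hp ω) (sq_nonneg _))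
      nlinarith [sq_nonneg (∑ ω, q ω * g ω)]
    have hbound : ∑ x, Q x * ((1 / (N : ℝ)) ^ 2 * (∑ i, (g (x i) - ∑ ω, q ω * g ω)) ^ 2)
        ≤ C * a * S2 / N := by
      have e3 : ∑ x, Q x * ((1 / (N : ℝ)) ^ 2 * (∑ i, (g (x i) - ∑ ω, q ω * g ω)) ^ 2)
          = (1 / (N : ℝ)) ^ 2 * ∑ x, Q x * (∑ i, (g (x i) - ∑ ω, q ω * g ω)) ^ 2 := by
        rw [mul_sum]; exact sum_congr rfl fun x _ => by ring
      rw [e3]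
      calc (1 / (N : ℝ)) ^ 2 * ∑ x, Q x * (∑ i, (g (x i) - ∑ ω, q ω * g ω)) ^ 2
          ≤ (1 / (N : ℝ)) ^ 2 * (C * N * (a * S2)) :=
            mul_le_mul_of_nonneg_left (hV.trans (mul_le_mul_of_nonneg_left hVq
              (mul_nonneg hC hNr.le))) (by positivity)
        _ = C * a * S2 / N := by field_simp
    calc Real.sqrt (∑ x, Q x * ((1 / (N : ℝ)) ^ 2 * (∑ i, (g (x i) - ∑ ω, q ω * g ω)) ^ 2))
        ≤ Real.sqrt (C * a * S2 / N) := Real.sqrt_le_sqrt hbound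
      _ ≤ Real.sqrt (C * Real.exp (-t / 2) * S2) := by
          refine Real.sqrt_le_sqrt ?_
          rw [div_le_iff₀ hNr]
          have haN : a ≤ Real.exp (-t / 2) * N := by
            calc a = Real.exp (-t / 2) * Real.exp (L + t) := by
                  rw [ha, ← Real.exp_add]; congr 1; ring
              _ ≤ Real.exp (-t / 2) * N := mul_le_mul_of_nonneg_left hN (Real.exp_pos _).le
          nlinarith [mul_nonneg hC hS20, haN]
      _ = Real.sqrt S2 * (Real.sqrt C * Real.exp (-t / 4)) := by
          rw [show C * Real.exp (-t / 2) * S2 = S2 * (C * Real.exp (-t / 2)) by ring,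
            Real.sqrt_mul hS20, Real.sqrt_mul hC,
            show Real.exp (-t / 2) = Real.exp (-t / 4) ^ 2 by
              rw [← Real.exp_nat_mul]; congr 1; push_cast; ring,
            Real.sqrt_sq (Real.exp_pos _).le]
  -- assemble
  calc ∑ x, Q x * |(1 / (N : ℝ)) * ∑ i, f (x i) * (p (x i) / q (x i)) - ∑ ω, p ω * f ω|
      ≤ ∑ x, Q x * ((1 / (N : ℝ)) * ∑ i, |f (x i) - h (x i)| * (p (x i) / q (x i))
          + |(1 / (N : ℝ)) * ∑ i, g (x i) - ∑ ω, p ω * h ω|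
          + ∑ ω, p ω * |f ω - h ω|) :=
        sum_le_sum fun x _ => mul_le_mul_of_nonneg_left (hsplit x) (hQ x)
    _ = ∑ x, Q x * ((1 / (N : ℝ)) * ∑ i, |f (x i) - h (x i)| * (p (x i) / q (x i)))
          + ∑ x, Q x * |(1 / (N : ℝ)) * ∑ i, g (x i) - ∑ ω, p ω * h ω|
          + (∑ x, Q x) * ∑ ω, p ω * |f ω - h ω| := by
        rw [sum_mul, ← sum_add_distrib, ← sum_add_distrib]
        exact sum_congr rfl fun x _ => by ring
    _ ≤ Real.sqrt S2 * Real.sqrt T + Real.sqrt S2 * (Real.sqrt C * Real.exp (-t / 4))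
          + 1 * (Real.sqrt S2 * Real.sqrt T) := by
        rw [hQ1]; exact add_le_add (add_le_add hterm1 hterm2) (by rw [one_mul, one_mul]; exact htail)
    _ = Real.sqrt S2 * (Real.sqrt C * Real.exp (-t / 4) + 2 * Real.sqrt T) := by ring

/-! ## §3 The NE-MCMC reading: correlated forward evolutions with a variance-inflation factor -/

section Jarzynski

variable {X : Type*} [Fintype X] [Nonempty X] {n : ℕ}

/-- **JARZYNSKI / REWEIGHTING SAMPLE SIZE, SUFFICIENCY, CORRELATED EVOLUTIONS.**  Actions `S`,
positive layers with unit row sums leaving the intermediate Boltzmann weights invariant,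
`ΔF = F(S_n) − F(S_0)`; ANY joint law `Q ≥ 0`, `Σ Q = 1` of `N ≥ 1` forward evolutions with `P_F`
one-evolution marginals and variance inflation `C` (`Var_Q(Σᵢ g(ωⁱ)) ≤ C·N·Var_{P_F}(g)` for all
`g`); any `t` with `N ≥ exp(ΔF − ⟨W⟩_R̃ + t)`.  Then for every path functional `f`:
`E_Q|(1/N)Σᵢ f(ωⁱ)e^{−(Wᵢ−ΔF)} − ⟨f⟩_R̃| ≤ √⟨f²⟩_R̃·(√C·e^{−t/4} + 2√(P̃_R{W < ⟨W⟩_R̃ − t/2}))`. -/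
theorem jarzynski_sampleSize_sufficient_of_varianceInflation (S : Fin (n + 1) → X → ℝ)
    (P : Fin n → X → X → ℝ) (hProw : ∀ k x, ∑ y, P k x y = 1) (hPpos : ∀ k x y, 0 < P k x y)
    (hst : ∀ k : Fin n, IsStationary (fun x => Real.exp (-(S k.succ x))) (P k))
    {N : ℕ} (hN0 : N ≠ 0) {Q : (Fin N → (Fin (n + 1) → X)) → ℝ} (hQ : ∀ x, 0 ≤ Q x)
    (hQ1 : ∑ x, Q x = 1)
    (hmarg : ∀ (i : Fin N) (g : (Fin (n + 1) → X) → ℝ),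
      ∑ x, Q x * g (x i) = ∑ ω, pathLaw (gibbsLaw (S 0)) P ω * g ω)
    {C : ℝ} (hC : 0 ≤ C)
    (hvar : ∀ g : (Fin (n + 1) → X) → ℝ,
      ∑ x, Q x * (∑ i, (g (x i) - ∑ ω, pathLaw (gibbsLaw (S 0)) P ω * g ω)) ^ 2
        ≤ C * N * ∑ ω, pathLaw (gibbsLaw (S 0)) P ω
          * (g ω - ∑ ω', pathLaw (gibbsLaw (S 0)) P ω' * g ω') ^ 2)
    (f : (Fin (n + 1) → X) → ℝ) {t : ℝ}
    (hN : Real.exp ((freeEnergy (S (Fin.last n)) - freeEnergy (S 0)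
      - ∑ ω, revPathLaw S P ω * work S ω) + t) ≤ N) :
    ∑ x, Q x * |(1 / (N : ℝ)) * ∑ i, f (x i)
          * Real.exp (-(work S (x i) - (freeEnergy (S (Fin.last n)) - freeEnergy (S 0))))
        - ∑ ω, revPathLaw S P ω * f ω|
      ≤ Real.sqrt (∑ ω, revPathLaw S P ω * f ω ^ 2) *
          (Real.sqrt C * Real.exp (-t / 4) + 2 * Real.sqrt
            (∑ ω, if work S ω < (∑ ω', revPathLaw S P ω' * work S ω') - t / 2
              then revPathLaw S P ω else 0)) := by
  classical
  have hR0 : ∀ ω, 0 ≤ revPathLaw S P ω := revPathLaw_nonneg S fun k x y => (hPpos k x y).le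
  have hkl := klFin_revPathLaw_pathLaw S P hPpos hst
  have h := sampleSize_sufficient_of_varianceInflation (p := revPathLaw S P)
    (q := pathLaw (gibbsLaw (S 0)) P) (fun ω => pathLaw_pos (gibbsLaw_pos _) hPpos ω)
    (sum_pathLaw_gibbsLaw_eq_one S P hProw) hR0 hN0 hQ hQ1 hmarg hC hvar f (t := t) (by rwa [hkl])
  simp_rw [revPathLaw_div_pathLaw S P hPpos, hkl] at h
  have hiff : ∀ ω, (Real.exp (freeEnergy (S (Fin.last n)) - freeEnergy (S 0)
      - ∑ ω', revPathLaw S P ω' * work S ω' + t / 2)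
        < Real.exp (-(work S ω - (freeEnergy (S (Fin.last n)) - freeEnergy (S 0)))))
      ↔ (work S ω < (∑ ω', revPathLaw S P ω' * work S ω') - t / 2) := fun ω => by
    rw [Real.exp_lt_exp]
    constructor <;> intro h <;> linarith
  simp_rw [hiff] at h
  exact h

end Jarzynski

end Summit.Ventures.LatticeQCDFlow.Theory2
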